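import Literature.AnabelianGeometry.SemiGraphs.ArithQuasiGeometricCompat
import HarnessLib

/-!
# [SemiAnbd] Thm 5.4 (iii), compatible reading — projections, constructor and the assembly shape
# (proof-only companion of `ArithQuasiGeometricCompat.lean`; row T54-7c (R1))

Mochizuki, *Semi-graphs of anabelioids*, Publ. RIMS **42** (2006), §5, Theorem 5.4 (iii), manuscript
p. 66 [cite: MochizukiSemiAnbd2006, Thm 5.4 (iii), p. 66].  PROOF-ONLY (cell abc-iut, layer L3, seat
abc-iut-w4-d083): the by-name API of the compatible reading `IsArithCompatiblyQuasiGeometric` /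
`ArithQuasiGeometricCorrespondenceStatementCompat` for its consumers — abc-iut-w5-d141's umbrella v3b
(`h1c` / `InnerEquiv` / `Thm54iii.clause3Compat_of_geometric`) and the junction (T54-B).  Nothing asserted;
nothing here bears on [IUTchIII] Cor. 3.12; typed ≠ proved.
-/

namespace Literature.AnabelianGeometry.SemiGraphs

open _root_.CategoryTheory

universe u v w uG uH uP

/-! ### The compatible reading of "arithmetically quasi-geometric" -/

section QuasiGeometric

variable {Gtp : Type uG} [Group Gtp] [TopologicalSpace Gtp]
variable {Htp : Type uH} [Group Htp] [TopologicalSpace Htp]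
variable {PA : Type uP} [Group PA] [TopologicalSpace PA]

/-- The compatible reading implies the literal one. [cite: MochizukiSemiAnbd2006, Thm 5.4 (iii), p. 66] -/
theorem IsArithCompatiblyQuasiGeometric.isArithQuasiGeometric {augG : Gtp →* PA} {augH : Htp →* PA}
    {φ : Gtp →* Htp} (h : IsArithCompatiblyQuasiGeometric augG augH φ) :
    IsArithQuasiGeometric augG augH φ :=
  h.1

/-- The compatibility clause of the compatible reading (the shape of the inline hypothesis of
abc-iut-w5-d141's `Thm54iii.clause3Compat_of_geometric`, verbatim). [cite: MochizukiSemiAnbd2006, Thm 5.4 (iii), p. 66] -/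
theorem IsArithCompatiblyQuasiGeometric.compat {augG : Gtp →* PA} {augH : Htp →* PA}
    {φ : Gtp →* Htp} (h : IsArithCompatiblyQuasiGeometric augG augH φ) :
    ∀ K₁ H₁ : Subgroup Gtp, IsArithMaximalCompact augG K₁ → IsArithMaximalCompact augG H₁ →
      K₁ ≠ H₁ → IsArithAmple augG (K₁ ⊓ H₁) →
        ∃ K₂ H₂ : Subgroup Htp, IsArithMaximalCompact augH K₂ ∧ IsArithMaximalCompact augH H₂ ∧
          K₂ ≠ H₂ ∧ K₁.map φ ≤ K₂ ∧ H₁.map φ ≤ H₂ :=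
  h.2

/-- Continuity and compatibility with the augmentations, read off the literal part.
[cite: MochizukiSemiAnbd2006, Thm 5.4 (iii), p. 66] -/
theorem IsArithCompatiblyQuasiGeometric.continuous_and_over {augG : Gtp →* PA} {augH : Htp →* PA}
    {φ : Gtp →* Htp} (h : IsArithCompatiblyQuasiGeometric augG augH φ) :
    Continuous φ ∧ augH.comp φ = augG :=
  ⟨h.1.1, h.1.2.1⟩

/-- Constructor: the literal condition together with the compatibility clause.
[cite: MochizukiSemiAnbd2006, Thm 5.4 (iii), p. 66] -/
theorem isArithCompatiblyQuasiGeometric_of_compat {augG : Gtp →* PA} {augH : Htp →* PA}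
    {φ : Gtp →* Htp} (h : IsArithQuasiGeometric augG augH φ)
    (hc : ∀ K₁ H₁ : Subgroup Gtp, IsArithMaximalCompact augG K₁ → IsArithMaximalCompact augG H₁ →
      K₁ ≠ H₁ → IsArithAmple augG (K₁ ⊓ H₁) →
        ∃ K₂ H₂ : Subgroup Htp, IsArithMaximalCompact augH K₂ ∧ IsArithMaximalCompact augH H₂ ∧
          K₂ ≠ H₂ ∧ K₁.map φ ≤ K₂ ∧ H₁.map φ ≤ H₂) :
    IsArithCompatiblyQuasiGeometric augG augH φ :=
  ⟨h, hc⟩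

end QuasiGeometric

/-! ### Theorem 5.4 (iii), compatible reading — statement over explicit inputs -/

section Thm54iii

variable {Obj : Type u} [Category.{v} Obj] {𝓥 : SemiAnbdVocab.{u, v, w} Obj}
variable (𝔊 ℍ : ArithSemiGraph 𝓥) (e : 𝔊.PA ≃* ℍ.PA)
variable {Gtp : Type uG} [Group Gtp] [TopologicalSpace Gtp]
variable {Htp : Type uH} [Group Htp] [TopologicalSpace Htp]

/-- **Assembly shape of the compatible statement from its three clauses** (for the umbrella v3b of
abc-iut-w5-d141: clause 1 compatible = binder `h1c` until the arithmetic R0′ is proved, clause 2 =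
`InnerEquiv` (row T54-6), clause 3 compatible = `Thm54iii.clause3Compat_of_geometric`).
[cite: MochizukiSemiAnbd2006, Thm 5.4 (iii), p. 66] -/
theorem arithQuasiGeometricCorrespondenceStatementCompat_of_clauses (augG : Gtp →* 𝔊.PA)
    (augH : Htp →* ℍ.PA)
    (btemp : (φ : ArithHom 𝓥 𝔊 ℍ) → φ.IsLocallyOpen → ArithHom.IsOverA 𝔊 ℍ e φ → (Gtp →* Htp))
    (h1c : ∀ (φ : ArithHom 𝓥 𝔊 ℍ) (h₁ : φ.IsLocallyOpen) (h₂ : ArithHom.IsOverA 𝔊 ℍ e φ),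
      IsArithCompatiblyQuasiGeometric augG (e.symm.toMonoidHom.comp augH) (btemp φ h₁ h₂))
    (h2 : ∀ (φ ψ : ArithHom 𝓥 𝔊 ℍ) (h₁ : φ.IsLocallyOpen) (h₂ : ArithHom.IsOverA 𝔊 ℍ e φ)
        (k₁ : ψ.IsLocallyOpen) (k₂ : ArithHom.IsOverA 𝔊 ℍ e ψ),
      ArithHom.InnerEquiv φ ψ ↔ ∃ h : Htp, ∀ g, btemp ψ k₁ k₂ g = h * btemp φ h₁ h₂ g * h⁻¹)
    (h3c : ∀ f : Gtp →* Htp, IsArithCompatiblyQuasiGeometric augG (e.symm.toMonoidHom.comp augH) f →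
      ∃ (φ : ArithHom 𝓥 𝔊 ℍ) (h₁ : φ.IsLocallyOpen) (h₂ : ArithHom.IsOverA 𝔊 ℍ e φ) (h : Htp),
        ∀ g, f g = h * btemp φ h₁ h₂ g * h⁻¹) :
    ArithQuasiGeometricCorrespondenceStatementCompat 𝔊 ℍ e augG augH btemp :=
  ⟨h1c, h2, h3c⟩

/-- The compatible statement implies clauses 2 and the literal clause 1 of the frozen statement (its clause 3
is the one NOT implied — O-T54-1). [cite: MochizukiSemiAnbd2006, Thm 5.4 (iii), p. 66] -/
theorem ArithQuasiGeometricCorrespondenceStatementCompat.clause1_literal {augG : Gtp →* 𝔊.PA}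
    {augH : Htp →* ℍ.PA}
    {btemp : (φ : ArithHom 𝓥 𝔊 ℍ) → φ.IsLocallyOpen → ArithHom.IsOverA 𝔊 ℍ e φ → (Gtp →* Htp)}
    (h : ArithQuasiGeometricCorrespondenceStatementCompat 𝔊 ℍ e augG augH btemp) :
    ∀ (φ : ArithHom 𝓥 𝔊 ℍ) (h₁ : φ.IsLocallyOpen) (h₂ : ArithHom.IsOverA 𝔊 ℍ e φ),
      IsArithQuasiGeometric augG (e.symm.toMonoidHom.comp augH) (btemp φ h₁ h₂) :=
  fun φ h₁ h₂ => (h.1 φ h₁ h₂).1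

end Thm54iii

end Literature.AnabelianGeometry.SemiGraphs
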